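import Literature.Computability.Cryptography.RegevReduction
import Literature.Computability.Cryptography.IndependentTrials
import Literature.Probability.Distributions.IndepProductLawDistance
import Literature.Probability.Distributions.IndepProductLawMeasure
import Literature.Algebra.EuclideanLattices.ARVerifierRandomWitness
import Literature.Algebra.EuclideanLattices.ARVerifierVectorCert
import Literature.Algebra.EuclideanLattices.RegevDualQueryMachine
import Literature.Algebra.EuclideanLattices.RegevDualQuery
import HarnessLib

/-!
# Regev's quantum reduction, `GapSVP` form, V: the laws of the `N` decoded samples (Lemma 3.20, NO case)

Topic `Computability/Cryptography` (family `pqc`). Probability-level piece of the proof of hypothesis `hL`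
(Regev 2009, Lemma 3.20 in machine form) of `regev_lwe_to_gapSVP_quantum_of_dgs` (`RegevReduction.lean`),
the NO case of the printed proof (author's version arXiv:2401.03703, p. 22): "if `(B, t, d)` is a NO
instance … `1/(100d) > √n γ(n)/λ₁(L)`, and hence `w₁, …, w_N` are guaranteed to be valid samples from
`D_{L*,1/(100d)}` … with probability exponentially close to `1`, `𝒱` accepts".

* **Squeezing a dominated law** (`PMF.toOuterMeasure_inter_preimage_eq_of_forall_le`, `PMF.map_eq_of_forall_le`):
  if `μ T ≤ κ (G ∩ ρ⁻¹ T)` for every event `T`, then `κ` gives mass `1` to `G`, and `ρ` pushes `κ`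
  forward to `μ` — the form in which the classical wrap of one sampler call (`CWrap.kernelProb_family_ge`,
  one-sided bounds for every event) pins down the law of the string read back off its block;
* **Products** (`indepLaw_toOuterMeasure_ge_of_forall_le`): for `K` independent blocks each dominating `μ`
  in that sense, `Pr_{⨂κⱼ}[(∀ j, sⱼ ∈ G) ∧ ρ ∘ s ∈ A] ≥ Pr_{μ^{⊗K}}[A]`, and the marginal of an i.i.d.
  `K`-tuple on its first `N` coordinates (`iidPMF_map_comp_castLE`);
* **The ideal samples** (§ Lattice): the query instance `⟨n, (adj(−B))ᵀ⟩` of `RegevDualQueryMachine` is the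
  scaled dual `det(−B) · L(B)*` (`queryLattice`, `mem_queryLattice_iff`), it is nonsingular and the query width
  `|det B|/(100d)` is admissible on NO instances of `GapCVP′_{100√n γ}` (`dgsBoundDual_queryInstance_lt`);
  its discrete Gaussian at that width is the image of `N` i.i.d. samples of `D_{L(B)*, 1/(100d)}` under
  `w ↦ det(−B) · w` (`target_eq_map`), every such image is an integer vector (`exists_intVec_eq_smul`),
  and on the event that the Aharonov–Regev certificate of the samples is accepted the integer vectors are
  accepted by `ARVerifier.MAccepts` (`preimage_acceptE_eq`); hence (`ideal_accept_ge`) under the ideal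
  product law the event `acceptE` has probability `≥ 829/1000` (`ARVerifierRandomWitness`).

Everything is proved; no named facts.

## References

* O. Regev, *On lattices, learning with errors, random linear codes, and cryptography*, J. ACM 56
  (2009), art. 34; author's version arXiv:2401.03703, Lemma 3.20 and its proof (p. 22). [Regev2009]
* D. Aharonov, O. Regev, *Lattice problems in NP ∩ coNP*, J. ACM 52 (2005) 749–765, §6.2. [AharonovRegev2005]
-/

noncomputable section

open scoped ENNReal

/-! ### Squeezing a dominated law -/

namespace PMF

variable {α β : Type*}

/-- **Complement rule** for the outer measure of a `PMF`: `Pr[s] + Pr[sᶜ] = 1` (twin of the lemma of the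
same name in `Probability/RandomGraphs/ErdosRenyiCylinder.lean`, outside this import cone). [folklore] -/
theorem toOuterMeasure_add_compl' (q : PMF α) (s : Set α) : q.toOuterMeasure s + q.toOuterMeasure sᶜ = 1 := by
  rw [PMF.toOuterMeasure_apply, PMF.toOuterMeasure_apply, ← ENNReal.tsum_add, ← q.tsum_coe]
  congr 1
  funext x
  by_cases hx : x ∈ s
  · rw [Set.indicator_of_mem hx, Set.indicator_of_notMem (show x ∉ sᶜ from fun h => h hx), add_zero]
  · rw [Set.indicator_of_notMem hx, Set.indicator_of_mem (show x ∈ sᶜ from hx), zero_add]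

/-- **Additivity on disjoint sets** for the outer measure of a `PMF`. [folklore] -/
theorem toOuterMeasure_union_of_disjoint (q : PMF α) {s t : Set α} (h : Disjoint s t) :
    q.toOuterMeasure (s ∪ t) = q.toOuterMeasure s + q.toOuterMeasure t := by
  rw [PMF.toOuterMeasure_apply, PMF.toOuterMeasure_apply, PMF.toOuterMeasure_apply, ← ENNReal.tsum_add]
  congr 1
  funext x
  rw [Set.indicator_union_of_disjoint h]

/-- Outer measures of a `PMF` are at most `1`. [folklore] -/
theorem toOuterMeasure_le_one' (q : PMF α) (s : Set α) : q.toOuterMeasure s ≤ 1 :=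
  (q.toOuterMeasure.mono (Set.subset_univ s)).trans_eq ((q.toOuterMeasure_apply_eq_one_iff _).2 (Set.subset_univ _))

/-- **Squeezing a dominated law, events**: if `μ T ≤ κ (G ∩ ρ⁻¹ T)` for every `T`, then equality holds for
every `T`. [folklore] -/
theorem toOuterMeasure_inter_preimage_eq_of_forall_le (κ : PMF α) (μ : PMF β) (G : Set α) (ρ : α → β)
    (h : ∀ T : Set β, μ.toOuterMeasure T ≤ κ.toOuterMeasure (G ∩ ρ ⁻¹' T)) (T : Set β) :
    κ.toOuterMeasure (G ∩ ρ ⁻¹' T) = μ.toOuterMeasure T := by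
  have hdisj : Disjoint (G ∩ ρ ⁻¹' T) (G ∩ ρ ⁻¹' Tᶜ) :=
    Set.disjoint_left.2 fun x hx hx' => hx'.2 hx.2
  have hunion : (G ∩ ρ ⁻¹' T) ∪ (G ∩ ρ ⁻¹' Tᶜ) ⊆ G := Set.union_subset Set.inter_subset_left Set.inter_subset_left
  have hsum : κ.toOuterMeasure (G ∩ ρ ⁻¹' T) + κ.toOuterMeasure (G ∩ ρ ⁻¹' Tᶜ) ≤ 1 := by
    rw [← toOuterMeasure_union_of_disjoint κ hdisj]
    exact toOuterMeasure_le_one' κ _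
  have h1 := h T
  have h2 := h Tᶜ
  have hμ := toOuterMeasure_add_compl' μ T
  -- `a + b = 1`, `a ≤ c`, `b ≤ d`, `c + d ≤ 1` with everything finite ⇒ `a = c`
  have hfin : ∀ s, κ.toOuterMeasure s ≠ ⊤ := fun s => ne_top_of_le_ne_top ENNReal.one_ne_top (toOuterMeasure_le_one' κ s)
  have hfinμ : ∀ s, μ.toOuterMeasure s ≠ ⊤ := fun s => ne_top_of_le_ne_top ENNReal.one_ne_top (toOuterMeasure_le_one' μ s)
  refine le_antisymm ?_ h1
  have key : κ.toOuterMeasure (G ∩ ρ ⁻¹' T) + μ.toOuterMeasure Tᶜ ≤ μ.toOuterMeasure T + μ.toOuterMeasure Tᶜ := by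
    rw [hμ]
    calc κ.toOuterMeasure (G ∩ ρ ⁻¹' T) + μ.toOuterMeasure Tᶜ
        ≤ κ.toOuterMeasure (G ∩ ρ ⁻¹' T) + κ.toOuterMeasure (G ∩ ρ ⁻¹' Tᶜ) := add_le_add le_rfl h2
      _ ≤ 1 := hsum
  exact (ENNReal.add_le_add_iff_right (hfinμ _)).1 key

/-- **… the good set has full mass.** [folklore] -/
theorem toOuterMeasure_eq_one_of_forall_le (κ : PMF α) (μ : PMF β) (G : Set α) (ρ : α → β)
    (h : ∀ T : Set β, μ.toOuterMeasure T ≤ κ.toOuterMeasure (G ∩ ρ ⁻¹' T)) : κ.toOuterMeasure G = 1 := by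
  have := toOuterMeasure_inter_preimage_eq_of_forall_le κ μ G ρ h Set.univ
  rw [Set.preimage_univ, Set.inter_univ] at this
  rw [this]
  exact (μ.toOuterMeasure_apply_eq_one_iff _).2 (Set.subset_univ _)

/-- **… its complement is null.** [folklore] -/
theorem toOuterMeasure_compl_eq_zero_of_forall_le (κ : PMF α) (μ : PMF β) (G : Set α) (ρ : α → β)
    (h : ∀ T : Set β, μ.toOuterMeasure T ≤ κ.toOuterMeasure (G ∩ ρ ⁻¹' T)) : κ.toOuterMeasure Gᶜ = 0 := by
  have h1 := toOuterMeasure_add_compl' κ G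
  rw [toOuterMeasure_eq_one_of_forall_le κ μ G ρ h] at h1
  have hfin : κ.toOuterMeasure Gᶜ ≠ ⊤ := ne_top_of_le_ne_top ENNReal.one_ne_top (toOuterMeasure_le_one' κ _)
  have : (1 : ℝ≥0∞) + κ.toOuterMeasure Gᶜ = 1 + 0 := by rw [add_zero]; exact h1
  exact (ENNReal.add_right_inj ENNReal.one_ne_top).1 this

/-- **… and `ρ` pushes `κ` forward to `μ`.** [folklore] -/
theorem map_eq_of_forall_le (κ : PMF α) (μ : PMF β) (G : Set α) (ρ : α → β)
    (h : ∀ T : Set β, μ.toOuterMeasure T ≤ κ.toOuterMeasure (G ∩ ρ ⁻¹' T)) : κ.map ρ = μ := by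
  refine PMF.ext fun b => ?_
  rw [← PMF.toOuterMeasure_apply_singleton, ← PMF.toOuterMeasure_apply_singleton, PMF.toOuterMeasure_map_apply,
    ← toOuterMeasure_inter_preimage_eq_of_forall_le κ μ G ρ h {b}]
  -- `κ (ρ⁻¹{b}) = κ (G ∩ ρ⁻¹{b}) + κ (Gᶜ ∩ ρ⁻¹{b})`, the second term null
  have hsplit : ρ ⁻¹' {b} = (G ∩ ρ ⁻¹' {b}) ∪ (Gᶜ ∩ ρ ⁻¹' {b}) := by
    rw [← Set.union_inter_distrib_right, Set.union_compl_self, Set.univ_inter]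
  have hdisj : Disjoint (G ∩ ρ ⁻¹' {b}) (Gᶜ ∩ ρ ⁻¹' {b}) :=
    Set.disjoint_left.2 fun x hx hx' => hx'.1 hx.1
  have hnull : κ.toOuterMeasure (Gᶜ ∩ ρ ⁻¹' {b}) = 0 :=
    le_antisymm ((κ.toOuterMeasure.mono Set.inter_subset_left).trans_eq (toOuterMeasure_compl_eq_zero_of_forall_le κ μ G ρ h))
      bot_le
  conv_lhs => rw [hsplit]
  rw [toOuterMeasure_union_of_disjoint κ hdisj, hnull, add_zero]

end PMF

/-! ### Products of dominated blocks -/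

namespace Literature.Computability.Cryptography

namespace Regev2009

namespace Lemma320

open LWE Literature.Probability.Distributions MeasureTheory

variable {α β : Type}

/-- **Products of dominated blocks**: if each of `K` independent block laws `κⱼ` dominates `μ` through `ρ`
on the good set `G`, then `Pr_{⨂κⱼ}[(∀ j, sⱼ ∈ G) ∧ ρ ∘ s ∈ A] ≥ Pr_{μ^{⊗K}}[A]` for every `A` (indeed
`=`; the inequality is what the reduction needs). [folklore] -/
theorem indepLaw_toOuterMeasure_ge_of_forall_le (K : ℕ) (κ : Fin K → PMF α) (μ : PMF β) (G : Set α) (ρ : α → β)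
    (h : ∀ j (T : Set β), μ.toOuterMeasure T ≤ (κ j).toOuterMeasure (G ∩ ρ ⁻¹' T)) (A : Set (Fin K → β)) :
    (iidPMF μ K).toOuterMeasure A ≤
      (indepLaw K κ).toOuterMeasure {s | (∀ j, s j ∈ G) ∧ (fun j => ρ (s j)) ∈ A} := by
  classical
  -- `μ^{⊗K}` is the image of `⨂κⱼ` under `ρ` coordinatewise
  have hmap : (indepLaw K κ).map (fun s j => ρ (s j)) = iidPMF μ K := by
    rw [indepLaw_map_pi, show (fun j => (κ j).map ρ) = fun _ => μ from funext fun j => PMF.map_eq_of_forall_le _ _ _ _ (h j),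
      indepLaw_const]
  rw [← hmap, PMF.toOuterMeasure_map_apply]
  -- split the preimage along the good event
  have hsub : (fun s j => ρ (s j)) ⁻¹' A ⊆ {s | (∀ j, s j ∈ G) ∧ (fun j => ρ (s j)) ∈ A} ∪ ⋃ j, {s : Fin K → α | s j ∈ Gᶜ} := by
    intro s hs
    by_cases hg : ∀ j, s j ∈ G
    · exact Or.inl ⟨hg, hs⟩
    · push Not at hg
      obtain ⟨j, hj⟩ := hg
      exact Or.inr (Set.mem_iUnion.2 ⟨j, hj⟩)
  have hnull : ∀ j, (indepLaw K κ).toOuterMeasure {s : Fin K → α | s j ∈ Gᶜ} = 0 := fun j => by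
    rw [indepLaw_toOuterMeasure_apply_preimage]
    exact PMF.toOuterMeasure_compl_eq_zero_of_forall_le _ _ _ _ (h j)
  calc (indepLaw K κ).toOuterMeasure ((fun s j => ρ (s j)) ⁻¹' A)
      ≤ (indepLaw K κ).toOuterMeasure ({s | (∀ j, s j ∈ G) ∧ (fun j => ρ (s j)) ∈ A} ∪ ⋃ j, {s : Fin K → α | s j ∈ Gᶜ}) :=
        (indepLaw K κ).toOuterMeasure.mono hsub
    _ ≤ (indepLaw K κ).toOuterMeasure {s | (∀ j, s j ∈ G) ∧ (fun j => ρ (s j)) ∈ A} +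
          (indepLaw K κ).toOuterMeasure (⋃ j, {s : Fin K → α | s j ∈ Gᶜ}) := measure_union_le _ _
    _ ≤ (indepLaw K κ).toOuterMeasure {s | (∀ j, s j ∈ G) ∧ (fun j => ρ (s j)) ∈ A} +
          ∑ j, (indepLaw K κ).toOuterMeasure {s : Fin K → α | s j ∈ Gᶜ} := by
        gcongr; exact measure_iUnion_fintype_le _ _
    _ = (indepLaw K κ).toOuterMeasure {s | (∀ j, s j ∈ G) ∧ (fun j => ρ (s j)) ∈ A} := by
        rw [Finset.sum_eq_zero (fun j _ => hnull j), add_zero]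

/-- **The marginal of an i.i.d. tuple on its first `N` coordinates is i.i.d.** [folklore] -/
theorem iidPMF_map_comp_castLE (μ : PMF α) {N K : ℕ} (hNK : N ≤ K) :
    (iidPMF μ K).map (fun v => v ∘ Fin.castLE hNK) = iidPMF μ N := by
  obtain ⟨r, rfl⟩ := Nat.exists_eq_add_of_le hNK
  have e : (fun v : Fin (N + r) → α => v ∘ Fin.castLE hNK) = fun v => fun j : Fin N => v (Fin.castAdd r j) := by
    funext v; funext j; rfl
  rw [e, ← indepLaw_const, indepLaw_map_castAdd, indepLaw_const]

/-- Events of the first `N` coordinates of an i.i.d. `K`-tuple have their i.i.d. `N`-tuple probability.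
[folklore] -/
theorem iidPMF_toOuterMeasure_comp_castLE (μ : PMF α) {N K : ℕ} (hNK : N ≤ K) (A : Set (Fin N → α)) :
    (iidPMF μ K).toOuterMeasure {v | v ∘ Fin.castLE hNK ∈ A} = (iidPMF μ N).toOuterMeasure A := by
  rw [← iidPMF_map_comp_castLE μ hNK, PMF.toOuterMeasure_map_apply]
  rfl

/-- Pushing an event of tuples through an injective coordinate map. [folklore] -/
theorem iidPMF_toOuterMeasure_image (μ : PMF α) (f : α → β) (hf : Function.Injective f) (N : ℕ) (A : Set (Fin N → α)) :
    (iidPMF (μ.map f) N).toOuterMeasure {w | ∃ v ∈ A, w = f ∘ v} = (iidPMF μ N).toOuterMeasure A := by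
  rw [← iidPMF_map, PMF.toOuterMeasure_map_apply]
  congr 1
  ext v
  simp only [Set.mem_preimage, Set.mem_setOf_eq]
  constructor
  · rintro ⟨v', hv', h⟩
    have : v' = v := funext fun j => hf (congrFun h j).symm
    exact this ▸ hv'
  · intro hv; exact ⟨v, hv, rfl⟩

/-! ### The ideal samples: the query instance, its law, integrality, acceptance -/

section Lattice

open Literature.Algebra.EuclideanLattices Literature.Algebra.EuclideanLattices.LatticeInstance ARVerifier Matrix
open scoped InnerProductSpace

variable (I : LatticeInstance) (t : Fin I.n → ℤ) (d : ℚ)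

/-- The instance `⟨n, −B⟩`: same lattice, and its `adjDual` is the query instance of the reduction.
[folklore] -/
abbrev negInst : LatticeInstance := ⟨I.n, -I.basis⟩

/-- `L(−B) = L(B)`. [folklore] -/
theorem negInst_lattice : (negInst I).lattice = I.lattice := by
  show Submodule.span ℤ (Set.range fun i : Fin I.n => intVecToEuclidean I.n ((-I.basis) i)) = Submodule.span ℤ (Set.range I.vec)
  have hneg : ∀ i : Fin I.n, intVecToEuclidean I.n ((-I.basis) i) = -I.vec i := fun i => by
    ext j
    simp [intVecToEuclidean_apply, LatticeInstance.vec_apply, Matrix.neg_apply]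
  have hset : (Set.range fun i : Fin I.n => intVecToEuclidean I.n ((-I.basis) i)) = -Set.range I.vec := by
    ext x
    simp only [Set.mem_range, Set.mem_neg, hneg]
    constructor
    · rintro ⟨i, rfl⟩; exact ⟨i, by rw [neg_neg]⟩
    · rintro ⟨i, hi⟩; exact ⟨i, by rw [hi, neg_neg]⟩
  rw [hset, Submodule.span_neg]

/-- `⟨n, −B⟩` is nonsingular when `⟨n, B⟩` is. [folklore] -/
theorem negInst_isNonsingular (hI : I.IsNonsingular) : (negInst I).IsNonsingular := by
  change (-I.basis).det ≠ 0
  rw [Matrix.det_neg]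
  exact mul_ne_zero (pow_ne_zero _ (by norm_num)) hI

/-- **The query instance is `adjDual ⟨n, −B⟩`** (definitionally). [cite: Regev2009, Lemma 3.20 (proof: the oracle is called on L*)] -/
theorem queryInstance_eq : RegevQuery.queryInstance I = (negInst I).adjDual := rfl

/-- The query instance is nonsingular. [folklore] -/
theorem queryInstance_isNonsingular (hI : I.IsNonsingular) : (RegevQuery.queryInstance I).IsNonsingular := by
  rw [queryInstance_eq]; exact adjDual_isNonsingular (negInst_isNonsingular I hI)

/-- **The query is admissible on NO instances of `GapCVP′_{100√n γ}`**: `√n γ(n)/λ₁(L(query)*) < |det B|/(100 d)`,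
the `DGS` bound `Regev2009.dgsBoundDual γ` of the query instance is below the query width ("in the case of
a NO instance we have `1/(100d) > √n γ(n)/λ₁(L)`", Regev p. 22). [cite: Regev2009, Lemma 3.20 (proof, p. 22)] -/
theorem abs_cast_det_negInst : |(((negInst I).basis.det : ℤ) : ℝ)| = |((I.basis.det : ℤ) : ℝ)| := by
  change |(((-I.basis).det : ℤ) : ℝ)| = _
  rw [Matrix.det_neg, Int.cast_mul, Int.cast_pow, Int.cast_neg, Int.cast_one, abs_mul, abs_pow, abs_neg, abs_one, one_pow, one_mul]

/-- The width as a real number: `|det(−B)| · (100 d)⁻¹`. [folklore] -/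
theorem queryWidth_cast (hd : 0 < d) :
    ((RegevQuery.queryWidth I d : ℚ) : ℝ) = |(((negInst I).basis.det : ℤ) : ℝ)| * (100 * (d : ℝ))⁻¹ := by
  rw [RegevQuery.queryWidth_eq I d hd, ← div_eq_mul_inv, abs_cast_det_negInst, Rat.cast_div, Rat.cast_abs, Rat.cast_intCast,
    Rat.cast_mul, Rat.cast_ofNat]

/-- **The query is admissible on NO instances of `GapCVP′_{100√n γ}`**: `√n γ(n)/λ₁(L(query)*) < |det B|/(100 d)`,
the `DGS` bound `Regev2009.dgsBoundDual γ` of the query instance is below the query width ("in the case of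
a NO instance we have `1/(100d) > √n γ(n)/λ₁(L)`", Regev p. 22). [cite: Regev2009, Lemma 3.20 (proof, p. 22)] -/
theorem dgsBoundDual_queryInstance_lt {γ : ℕ → ℝ} (hγ : 0 ≤ γ I.n) (hI : I.IsNonsingular) (hd : 0 < d)
    (hfar : 100 * Real.sqrt I.n * γ I.n * (d : ℝ) < minNorm I.lattice) :
    Regev2009.dgsBoundDual γ (RegevQuery.queryInstance I) < ((RegevQuery.queryWidth I d : ℚ) : ℝ) := by
  have hJ := negInst_isNonsingular I hI
  have hd' : (0 : ℝ) < d := by exact_mod_cast hd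
  have hlt := div_minNorm_dualLattice_adjDualLattice_lt (I := negInst I) hJ (a := Real.sqrt I.n * γ I.n) (b := 100 * d)
    (by positivity) (by positivity) (by rw [negInst_lattice]; linarith [hfar, show Real.sqrt I.n * γ I.n * (100 * (d : ℝ)) = 100 * Real.sqrt I.n * γ I.n * d by ring])
  rw [queryWidth_cast I d hd, ← div_eq_mul_inv]
  exact hlt

/-- The scaling map `w ↦ det(−B) · w` of dual vectors into `ℝⁿ`. [cite: Regev2009, Lemma 3.20 (proof: the scaled samples)] -/
def scaleDual (w : dualLattice I.lattice) : EuclideanSpace ℝ (Fin I.n) := (((-I.basis).det : ℤ) : ℝ) • (w : EuclideanSpace ℝ (Fin I.n))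

/-- **The query lattice** `L(⟨n, (adj(−B))ᵀ⟩) ⊆ ℝⁿ`, as a submodule of the ambient space of the instance (the
lattice of `RegevQuery.queryInstance I`, whose dimension field is `I.n` only definitionally). [cite: Regev2009, Lemma 3.20 (proof)] -/
def queryLattice : Submodule ℤ (EuclideanSpace ℝ (Fin I.n)) := (RegevQuery.queryInstance I).lattice

/-- The query lattice is discrete. [folklore] -/
instance instDiscreteTopologyQueryLattice : DiscreteTopology (queryLattice I) :=
  LatticeInstance.instDiscreteTopologyLattice (RegevQuery.queryInstance I)

/-- Membership in the query lattice: `x ∈ L(query) ↔ det(−B)⁻¹ x ∈ L(B)*`. [folklore] -/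
theorem mem_queryLattice_iff (hI : I.IsNonsingular) (x : EuclideanSpace ℝ (Fin I.n)) :
    x ∈ queryLattice I ↔ ((((-I.basis).det : ℤ) : ℝ))⁻¹ • x ∈ dualLattice I.lattice := by
  have h := mem_adjDualLattice_iff (I := negInst I) (negInst_isNonsingular I hI) x
  rw [negInst_lattice] at h
  exact h

/-- **The ideal law of one decoded sample is the scaled dual Gaussian**: the discrete Gaussian of the
query lattice at the query width, pushed into `ℝⁿ`, is the image of `D_{L(B)*, 1/(100d)}` under
`w ↦ det(−B) · w`. [cite: Regev2009, Lemma 3.20 (proof: "w₁, …, w_N are valid samples from D_{L*,1/(100d)}")] -/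
theorem target_eq_map (hI : I.IsNonsingular) (hd : 0 < d) :
    haveI := isZLattice_of_isNonsingular hI
    (discreteGaussian (queryLattice I) ((RegevQuery.queryWidth I d : ℚ) : ℝ) 0).map Subtype.val =
      (dualGaussian I.lattice (100 * (d : ℝ))).map (scaleDual I) := by
  haveI := isZLattice_of_isNonsingular hI
  have hd' : (0 : ℝ) < d := by exact_mod_cast hd
  have hr : (0 : ℝ) < (100 * (d : ℝ))⁻¹ := by positivity
  have hc : ((((-I.basis).det : ℤ) : ℝ)) ≠ 0 := by
    have := negInst_isNonsingular I hI
    exact_mod_cast this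
  have h := discreteGaussian_map_val_eq_of_smul (L := dualLattice I.lattice) (M := queryLattice I) hc (mem_queryLattice_iff I hI) hr
  rw [queryWidth_cast I d hd]
  exact h

/-- **Scaled dual vectors are integer vectors**: `det(−B) · w = (−adj(−B)) (B w)` for `w ∈ L(B)*`.
[cite: Regev2009, Lemma 3.20 (proof)] -/
def intVecOf (w : dualLattice I.lattice) : Fin I.n → ℤ := (-(-I.basis).adjugate) *ᵥ dualCoords w

/-- `castVec (intVecOf w) = det(−B) · coords w`. [folklore] -/
theorem castVec_intVecOf (w : dualLattice I.lattice) :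
    castVec (intVecOf I w) = (((-I.basis).det : ℤ) : ℝ) • coords (w : EuclideanSpace ℝ (Fin I.n)) := by
  have hCB : (-(-I.basis).adjugate) * I.basis = (-I.basis).det • (1 : Matrix (Fin I.n) (Fin I.n) ℤ) := by
    rw [neg_mul, ← Matrix.mul_neg, Matrix.adjugate_mul]
  rw [intVecOf, castVec_mulVec, ← basis_mulVec_coords, Matrix.mulVec_mulVec, ← Matrix.map_mul, hCB, Matrix.smul_one_eq_diagonal,
    Matrix.diagonal_map (map_zero _)]
  ext i
  rw [Matrix.mulVec_diagonal]
  simp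

/-- `intVecToEuclidean (intVecOf w) = det(−B) · w`. [folklore] -/
theorem intVecToEuclidean_intVecOf (w : dualLattice I.lattice) : intVecToEuclidean I.n (intVecOf I w) = scaleDual I w := by
  have h := castVec_intVecOf I w
  ext i
  have := congrFun h i
  rw [castVec_apply] at this
  rw [intVecToEuclidean_apply, this, scaleDual]
  simp [coords]

/-- **The acceptance event of the decoded samples, in `ℝⁿ`**: the tuples of images of integer vectors
accepted by the machine form `MAccepts` of the Aharonov–Regev verifier. [cite: Regev2009, Lemma 3.20 (proof: "𝒱 accepts")] -/
def acceptE : Set (Fin (nSamples I.n) → EuclideanSpace ℝ (Fin I.n)) :=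
  {w | ∃ v ∈ {v : Fin (nSamples I.n) → Fin I.n → ℤ | ARVerifier.MAccepts I.basis t d v}, w = (intVecToEuclidean I.n) ∘ v}

/-- **Scaled dual samples fall in the acceptance event iff their certificate is accepted.**
[cite: Regev2009, Lemma 3.20 (proof, NO case)] [cite: AharonovRegev2005, §6.2 — variant] -/
theorem preimage_acceptE_eq (hI : I.IsNonsingular) :
    (fun ω : Fin (nSamples I.n) → dualLattice I.lattice => fun j => scaleDual I (ω j)) ⁻¹' acceptE I t d =
      {ω | ARVerifier.Accepts I.basis t d (ARVerifier.certOf I t ω)} := by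
  ext ω
  simp only [Set.mem_preimage, acceptE, Set.mem_setOf_eq]
  constructor
  · rintro ⟨v, hv, hEq⟩
    have hv' : ∀ j, castVec (v j) = (((-I.basis).det : ℤ) : ℝ) • coords (ω j : EuclideanSpace ℝ (Fin I.n)) := fun j => by
      have hj := congrFun hEq j
      simp only [Function.comp_apply] at hj
      funext i
      have := congrArg (fun x : EuclideanSpace ℝ (Fin I.n) => x i) hj
      simp only [scaleDual, PiLp.smul_apply, smul_eq_mul, intVecToEuclidean_apply] at this
      rw [castVec_apply, ← this]
      rfl
    exact (mAccepts_iff_accepts_certOf t hI d hv').1 hv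
  · intro hacc
    refine ⟨fun j => intVecOf I (ω j), (mAccepts_iff_accepts_certOf t hI d (fun j => castVec_intVecOf I (ω j))).2 hacc, ?_⟩
    funext j
    exact (intVecToEuclidean_intVecOf I (ω j)).symm

/-- **Under the ideal product law the acceptance event has probability `≥ 829/1000`** on NO instances of
`GapCVP′_{100√n γ}`, `γ ≥ 1`: the `N` i.i.d. scaled dual Gaussian samples are accepted by the verifier
(`ARVerifierRandomWitness.le_measureReal_accepts_certOf_of_gapCVP'_no`, transported to the `PMF` product
`iidPMF`). [cite: Regev2009, Lemma 3.20 (proof, NO case, p. 22)] [cite: AharonovRegev2005, §6.2 (Completeness) — variant] -/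
theorem ideal_accept_ge {γ : ℕ → ℝ} (hγ : ∀ n, 1 ≤ γ n)
    (hp : ((⟨I, t⟩ : CVPInstance), d) ∈ GapCVP'.no (fun k => 100 * Real.sqrt k * γ k)) :
    haveI := isZLattice_of_isNonsingular hp.1
    (829 : ℝ) / 1000 ≤ ((iidPMF ((dualGaussian I.lattice (100 * (d : ℝ))).map (scaleDual I)) (nSamples I.n)).toOuterMeasure
      (acceptE I t d)).toReal := by
  haveI := isZLattice_of_isNonsingular hp.1
  have h := le_measureReal_accepts_certOf_of_gapCVP'_no hγ hp
  rw [← iidPMF_map, PMF.toOuterMeasure_map_apply]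
  change (829 : ℝ) / 1000 ≤ ((iidPMF (dualGaussian I.lattice (100 * (d : ℝ))) (nSamples I.n)).toOuterMeasure
    ((fun ω : Fin (nSamples I.n) → dualLattice I.lattice => fun j => scaleDual I (ω j)) ⁻¹' acceptE I t d)).toReal
  rw [preimage_acceptE_eq I t d hp.1, ← indepLaw_const, ← measureReal_indepLaw_eq_toReal, toMeasure_indepLaw]
  exact h

end Lattice

end Lemma320

end Regev2009

end Literature.Computability.Cryptography

end
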